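import Summits.AtomisticToContinuum.HydrodynamicLimit.Theorems.BoxDissipativeWeakStrongRelativeEnergyStabilityGronwallIntegrablePieces
import Summits.AtomisticToContinuum.HydrodynamicLimit.Theorems.BoxDissipativeWeakStrongRelativeEnergyStabilityCutEosMaster
import HarnessLib

/-!
# Crux `RelativeEnergyStability` (stmt-AtomisticToContinuum-17653), line `registered`, heart stub S-X — part 9d:
# small analytic preliminaries of the Grönwall assembly

`sx_smallness` (the smallness scales of `Z = 1 + ηF'` and `(ηZ)'` at `η = 0` feeding `co_coercive_on_compact`),
`sx_window_eventually` (light one-particle boxes along a kinetic window) and an elementary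
squeeze lemma.
-/

noncomputable section

namespace Summit.AtomisticToContinuum.HydrodynamicLimit.Theorems.RES

open MeasureTheory Filter Set Function
open scoped Topology ENNReal
open Summit.AtomisticToContinuum.HydrodynamicLimit.Theses.BoxDissipativeWeakStrong
open Literature.MathematicalPhysics.KineticTheory Literature.Analysis.FluidPDE

/-! ## Small analytic inputs -/

/-- **Smallness scales at `η = 0`**: for `η₁` below a threshold, `(ηZ)' = 1 + 2ηF' + η²F'' ≥ 1/2` on `(0,η₁)`,
`Z(η₁) = 1 + η₁F'(η₁) ≥ 1/2` and the cut compressibility is positive (the hypotheses of `co_coercive_on_compact`). -/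
theorem sx_smallness {η₀ : ℝ} {F : ℝ → ℝ} (hη₀ : 0 < η₀) (hF : AnalyticOnNhd ℝ F (Ioo (-η₀) η₀))
    (hEq : EqOn hsExcessFreeEnergy F (Ico 0 η₀)) :
    ∃ ηe : ℝ, 0 < ηe ∧ ∀ η₁ : ℝ, 0 < η₁ → η₁ < ηe →
      (∀ η ∈ Ioo 0 η₁, (1 / 2 : ℝ) ≤ 1 + 2 * η * deriv F η + η ^ 2 * deriv (deriv F) η) ∧
      ((1 / 2 : ℝ) ≤ 1 + η₁ * deriv F η₁) ∧ (∀ η, 0 < η → 0 < cutCompressibility η₁ η) := by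
  have h0U : (0 : ℝ) ∈ Ioo (-η₀) η₀ := ⟨by linarith, hη₀⟩
  have hF1c : ContinuousAt (deriv F) 0 := hF.deriv.continuousOn.continuousAt (isOpen_Ioo.mem_nhds h0U)
  have hF2c : ContinuousAt (deriv (deriv F)) 0 :=
    hF.deriv.deriv.continuousOn.continuousAt (isOpen_Ioo.mem_nhds h0U)
  obtain ⟨ε₁, hε₁, hWε⟩ := cm_near_one (g := fun η => 1 + 2 * η * deriv F η + η ^ 2 * deriv (deriv F) η)
    (by fun_prop) (by simp)
  obtain ⟨ε₂, hε₂, hZf⟩ := cm_near_one (g := fun η => 1 + η * deriv F η) (by fun_prop) (by simp)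
  refine ⟨min (min ε₁ ε₂) (η₀ / 2), lt_min (lt_min hε₁ hε₂) (by linarith), ?_⟩
  intro η₁ hη₁ hη₁d
  have hη₁ε₁ : η₁ < ε₁ := hη₁d.trans_le ((min_le_left _ _).trans (min_le_left _ _))
  have hη₁ε₂ : η₁ < ε₂ := hη₁d.trans_le ((min_le_left _ _).trans (min_le_right _ _))
  have hη₁₀ : η₁ < η₀ := by linarith [hη₁d.trans_le (min_le_right (min ε₁ ε₂) (η₀ / 2))]
  refine ⟨fun η hη => (hWε η (by rw [abs_of_pos hη.1]; linarith [hη.2])).1.le,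
    (hZf η₁ (by rw [abs_of_pos hη₁]; linarith)).1.le, fun η hη => ?_⟩
  have hm0 : 0 < min η η₁ := lt_min hη hη₁
  have h := hZf (min η η₁) (by rw [abs_of_pos hm0]; linarith [min_le_right η η₁])
  rw [cutCompressibility, hsCompressibility_eq hEq ⟨hm0, (min_le_right _ _).trans_lt hη₁₀⟩]
  linarith [h.1]

/-- A window with `(N+1)ℓ_N³ → ∞` eventually has light one-particle boxes: `((N+1)ℓ_N³)⁻¹ ≤ c` for any `c > 0`. -/
theorem sx_window_eventually {ℓ : ℕ → ℝ} (hw : IsKineticWindow ℓ) {c : ℝ} (hc : 0 < c) :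
    ∀ᶠ N : ℕ in atTop, ((N : ℝ) + 1)⁻¹ * (ℓ N ^ 3)⁻¹ ≤ c := by
  filter_upwards [hw.2.2.eventually_ge_atTop c⁻¹] with N hN
  have hpos : 0 < c⁻¹ := inv_pos.2 hc
  rw [← mul_inv, mul_comm]
  calc (ℓ N ^ 3 * ((N : ℝ) + 1))⁻¹ ≤ (c⁻¹)⁻¹ := inv_anti₀ hpos hN
    _ = c := inv_inv c

/-- A real sequence squeezed between `0` (eventually) and every `ε > 0` (eventually) tends to `0`. -/
theorem sx_tendsto_zero_of_eventually_le {g : ℕ → ℝ} (h0 : ∀ᶠ N in atTop, 0 ≤ g N)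
    (hε : ∀ ε > (0 : ℝ), ∀ᶠ N in atTop, g N ≤ ε) : Tendsto g atTop (𝓝 0) := by
  rw [Metric.tendsto_atTop']
  intro ε hε'
  obtain ⟨N₀, hN₀⟩ := eventually_atTop.1 (h0.and (hε (ε / 2) (by positivity)))
  refine ⟨N₀, fun N hN => ?_⟩
  obtain ⟨h1, h2⟩ := hN₀ N hN.le
  rw [Real.dist_eq, abs_lt]
  constructor <;> linarith

end Summit.AtomisticToContinuum.HydrodynamicLimit.Theorems.RES

end
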